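import Summits.ValiantsHypothesis.ValiantsHypothesis.Theorems.GeneratorObstructionsPerGenDegreeSuperQPModularCollapseCone

/-!
# Route GeneratorObstructions — K1 `PerGenDegreeSuperQP` (stmt-ValiantsHypothesis-11654),
# line `per-side-atoms`: the DESIGN CRITERION — a labelled collapse `per_m(x_{ik} ↦ y_{ℓ(i,k)})`
# with separating characters and a flat positive coupling hits the ray `j` of `S(per_m)`

Abstraction of `…ModularCollapse{,Cone,Rays}` (the case `ℓ(i,k) = (i+k) mod j`). For an ARBITRARY
label map `ℓ : [m] × [m] → [j]` the LABELLED COLLAPSE is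
`Q_ℓ := per_m(x_{ik} ↦ y_{ℓ(i,k)}) = ∑_σ ∏_i y_{ℓ(σ i, i)}`, a form of degree `m` in `j` variables.
A **design** for `ℓ` consists of
(1') SEPARATING CHARACTERS: for all `y ≠ y'` a diagonal `d : [j] → ℂ` with `∏_i d_{ℓ(σ i, i)} = 1`
     for every permutation `σ` (so `diag(d)` fixes `Q_ℓ`) and `d_y ≠ d_{y'}`;
(2') a FLAT POSITIVE COUPLING: a doubly stochastic `m × m` matrix `M` with all entries `> 0` whose
     `ℓ`-profile `∑_{ℓ(i',i) = y} M_{i i'}` is the same positive constant for every label `y`.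
Then (this file):
* `isPolystable_labelCollapse_of_design` — `Q_ℓ` is POLYSTABLE (corrected BI 2017 Prop. 2.8:
  (2') and the full-support Birkhoff mixture `exists_pos_weights_of_pos_doublyStochastic` give
  rational `c_α > 0` on all of `supp Q_ℓ` with `∑ c_α α = (1,…,1)` — `labelCollapse_posCone`);
* `rename_labelCollapse_mem_orbitClosure_per` — `Q_ℓ` placed by ANY map `κ : [j] → MatIdx m` is a
  renaming of `per_m`, hence in `Δ(per_m)`;
* `per_ray_hit_of_design`, `per_exists_ray_atom_of_design` — **for `1 ≤ j ≤ m²`, a design for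
  some `ℓ : [m]² → [j]` (with every label used, automatic from (2')) makes the chamber ray `(1^j)^*`
  of `S(per_m)` HIT, with an ATOM at its first weight** (ray criterion of `…RayCriterion`).
So occupancy of a ray `j` is reduced to a FINITE DESIGN PROBLEM per `(m, j)` — e.g. additive labels
`ℓ(i,k) = a(i) + b(k) ∈ ℤ/j` always satisfy (1') (characters of `ℤ/j`), leaving only the linear
feasibility question (2') for `M`, an LP in `m²` unknowns. Known solutions: `j ≤ m` (modular
collapse), `j = r₁r₂`, `j = r + p` (`r_i ∣ m`); `j = m² - 1` has NO labelled design for `m ≥ 3`.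
Honest framing: unconditional structure theorems (a criterion); `stub_atomLate` (`c ≥ 2`), K1 and
`GenFlipThesis` remain OPEN; first-occurrence degrees untouched; nothing bears on VP versus VNP.
References: [BurgisserIkenmeyer2017] Prop. 2.8 (corrected, tree erratum A31), Def. 3.3;
[MulmuleySohoni2001] §4; [MumfordFogartyKirwan1994] Ch. 2 §1.
-/

set_option linter.dupNamespace false

noncomputable section

namespace Summit.ValiantsHypothesis.ValiantsHypothesis.Theorems.GeneratorObstructions.PerGenDegreeSuperQP

open MvPolynomial
open Literature.NumberTheory.DiophantineGeometry Literature.Computability.AlgebraicComplexity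
  Literature.Computability.Complexity

/-! ### 1. The labelled collapse `Q_ℓ` -/

section LabelCollapse

variable {m j : ℕ} (lab : Fin m × Fin m → Fin j)

/-- **The labelled collapse as a sum over permutations**: `Q_ℓ = ∑_σ ∏_i y_{ℓ(σ i, i)}`.
[folklore] -/
theorem labelCollapse_eq_sum :
    MvPolynomial.rename lab (perPoly (Fin m) ℂ) =
      ∑ σ : Equiv.Perm (Fin m), ∏ i : Fin m, X (lab (σ i, i)) := by
  rw [perPoly_eq_sum_prod, map_sum]
  simp only [map_prod, rename_X]

/-- The `σ`-th product of variables of `Q_ℓ` is the monomial with exponent the LABEL CONTENT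
`e_σ = ∑_i ε_{ℓ(σ i, i)}`. [folklore] -/
theorem prod_X_eq_monomial_sum_single_label (σ : Equiv.Perm (Fin m)) :
    (∏ i : Fin m, X (lab (σ i, i)) : MvPolynomial (Fin j) ℂ) =
      monomial (∑ i : Fin m, Finsupp.single (lab (σ i, i)) 1) 1 := by
  rw [monomial_sum_one]
  rfl

/-- **Coefficients of the labelled collapse count permutations** with a given label content.
[folklore] -/
theorem coeff_labelCollapse (α : Fin j →₀ ℕ) :
    coeff α (MvPolynomial.rename lab (perPoly (Fin m) ℂ)) =
      ((Finset.univ.filter fun σ : Equiv.Perm (Fin m) =>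
        (∑ i : Fin m, Finsupp.single (lab (σ i, i)) 1) = α).card : ℂ) := by
  classical
  rw [labelCollapse_eq_sum, coeff_sum]
  simp only [prod_X_eq_monomial_sum_single_label, coeff_monomial, Finset.sum_boole]

/-- The support of the labelled collapse is exactly the set of label contents `e_σ` (positive
integer coefficients: no cancellation). [folklore] -/
theorem mem_support_labelCollapse_iff (α : Fin j →₀ ℕ) :
    α ∈ (MvPolynomial.rename lab (perPoly (Fin m) ℂ)).support ↔
      ∃ σ : Equiv.Perm (Fin m), (∑ i : Fin m, Finsupp.single (lab (σ i, i)) 1) = α := by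
  classical
  rw [mem_support_iff, coeff_labelCollapse, Nat.cast_ne_zero, ← Nat.pos_iff_ne_zero, Finset.card_pos,
    Finset.filter_nonempty_iff]
  simp

/-- The labelled collapse is a form of degree `m`. [folklore] -/
theorem labelCollapse_isHomogeneous :
    (MvPolynomial.rename lab (perPoly (Fin m) ℂ)).IsHomogeneous m := by
  simpa [Fintype.card_fin] using
    (perPoly_isHomogeneous (n := Fin m) (k := ℂ)).rename_isHomogeneous (f := lab)

/-- The labelled collapse is nonzero (the label content `e_1` occurs). [folklore] -/
theorem labelCollapse_ne_zero : MvPolynomial.rename lab (perPoly (Fin m) ℂ) ≠ 0 := by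
  intro h
  have hmem := (mem_support_labelCollapse_iff lab _).mpr ⟨1, rfl⟩
  rw [h, support_zero] at hmem
  exact absurd hmem (Finset.notMem_empty _)

/-- **Diagonal substitutions fixing the labelled collapse**: if `∏_i d(ℓ(σ i, i)) = 1` for every
permutation `σ`, then `diag(d)` fixes `Q_ℓ`. [folklore] -/
theorem linSubst_diagonal_labelCollapse_eq (d : Fin j → ℂ)
    (hd : ∀ σ : Equiv.Perm (Fin m), ∏ i : Fin m, d (lab (σ i, i)) = 1) :
    linSubst (Fin j) ℂ (Matrix.diagonal d) (MvPolynomial.rename lab (perPoly (Fin m) ℂ)) =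
      MvPolynomial.rename lab (perPoly (Fin m) ℂ) := by
  classical
  rw [labelCollapse_eq_sum, map_sum]
  refine Finset.sum_congr rfl fun σ _ => ?_
  rw [prod_X_eq_monomial_sum_single_label, linSubst_diagonal_monomial]
  have hprod : ((∑ i : Fin m, Finsupp.single (lab (σ i, i)) 1).prod fun x n => d x ^ n) = 1 := by
    rw [← hd σ, ← Finsupp.prod_finsetSum_index (fun _ => pow_zero _) (fun _ _ _ => pow_add _ _ _)]
    refine Finset.prod_congr rfl fun i _ => ?_
    rw [Finsupp.prod_single_index (h := fun x n => d x ^ n) (pow_zero _), pow_one]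
  rw [hprod, one_smul]

end LabelCollapse

/-! ### 2. The positive cone from a flat positive coupling; polystability -/

section Design

variable {m j : ℕ} (lab : Fin m × Fin m → Fin j)

/-- **Positive cone from a flat positive coupling** (hypothesis 2 of the corrected BI 2017
Prop. 2.8 for `Q_ℓ`): if `M` is a doubly stochastic `m × m` matrix with positive entries whose
`ℓ`-profile `∑_{i,i' : ℓ(i',i) = y} M_{i i'} = κ` is the same constant `κ > 0` for every label `y`,
then there are rational `c_α > 0` on all of `supp Q_ℓ` with `∑_α c_α α_y = 1` for every `y`:
`c_α = κ⁻¹ ∑_{e_σ = α} w_σ` for positive permutation weights `w` of `M`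
(`exists_pos_weights_of_pos_doublyStochastic`). [cite: BurgisserIkenmeyer2017, Prop. 2.8 (corrected) and Cor. 2.9 (proof)] -/
theorem labelCollapse_posCone (M : Matrix (Fin m) (Fin m) ℚ) (hpos : ∀ i i', 0 < M i i')
    (hrow : ∀ i, ∑ i', M i i' = 1) (hcol : ∀ i', ∑ i, M i i' = 1) (κ : ℚ) (hκ : 0 < κ)
    (hflat : ∀ y : Fin j, ∑ i : Fin m, ∑ i' : Fin m, (if lab (i', i) = y then M i i' else 0) = κ) :
    ∃ c : (Fin j →₀ ℕ) → ℚ,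
      (∀ α ∈ (MvPolynomial.rename lab (perPoly (Fin m) ℂ)).support, 0 < c α) ∧
      ∀ y : Fin j, ∑ α ∈ (MvPolynomial.rename lab (perPoly (Fin m) ℂ)).support, c α * (α y : ℚ) = 1 := by
  classical
  obtain ⟨w, hwpos, hwM⟩ := exists_pos_weights_of_pos_doublyStochastic M hpos hrow hcol
  set e : Equiv.Perm (Fin m) → (Fin j →₀ ℕ) := fun σ =>
    ∑ i : Fin m, Finsupp.single (lab (σ i, i)) 1 with hedef
  set Q := MvPolynomial.rename lab (perPoly (Fin m) ℂ) with hQdef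
  have hsupp : ∀ α, α ∈ Q.support ↔ ∃ σ, e σ = α := fun α => mem_support_labelCollapse_iff lab α
  refine ⟨fun α => κ⁻¹ * ∑ σ ∈ Finset.univ.filter (fun σ => e σ = α), w σ, ?_, ?_⟩
  · intro α hα
    obtain ⟨σ, hσ⟩ := (hsupp α).mp hα
    have hsum : 0 < ∑ τ ∈ Finset.univ.filter (fun τ => e τ = α), w τ :=
      Finset.sum_pos (fun τ _ => hwpos τ) ⟨σ, by simp [hσ]⟩
    positivity
  · intro y
    have hmaps : ∀ σ ∈ (Finset.univ : Finset (Equiv.Perm (Fin m))), e σ ∈ Q.support :=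
      fun σ _ => (hsupp _).mpr ⟨σ, rfl⟩
    have key : ∑ α ∈ Q.support, (∑ σ ∈ Finset.univ.filter (fun σ => e σ = α), w σ) * (α y : ℚ) =
        ∑ σ : Equiv.Perm (Fin m), w σ * ((e σ) y : ℚ) := by
      rw [← Finset.sum_fiberwise_of_maps_to hmaps]
      refine Finset.sum_congr rfl fun α _ => ?_
      rw [Finset.sum_mul]
      exact Finset.sum_congr rfl fun σ hσ => by rw [(Finset.mem_filter.mp hσ).2]
    have h1 : ∀ σ : Equiv.Perm (Fin m), ((e σ) y : ℚ) =
        ∑ i : Fin m, if lab (σ i, i) = y then (1 : ℚ) else 0 := by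
      intro σ
      simp only [hedef, Finsupp.coe_finsetSum, Finset.sum_apply, Finsupp.single_apply]
      push_cast
      rfl
    have h2 : ∀ i : Fin m, ∑ σ : Equiv.Perm (Fin m), w σ * (if lab (σ i, i) = y then (1 : ℚ) else 0) =
        ∑ i' : Fin m, if lab (i', i) = y then M i i' else 0 := by
      intro i
      rw [← Finset.sum_fiberwise_of_maps_to (g := fun σ : Equiv.Perm (Fin m) => σ i)
        (fun σ _ => Finset.mem_univ (σ i))]
      refine Finset.sum_congr rfl fun i' _ => ?_
      rw [Finset.sum_congr rfl fun σ hσ => by rw [(Finset.mem_filter.mp hσ).2]]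
      by_cases h : lab (i', i) = y
      · simp_rw [if_pos h, mul_one]
        rw [← hwM i i', Finset.sum_filter]
        exact Finset.sum_congr rfl fun σ _ => by rw [mul_ite, mul_one, mul_zero]
      · simp_rw [if_neg h, mul_zero]
        exact Finset.sum_const_zero
    have htot : ∑ σ : Equiv.Perm (Fin m), w σ * ((e σ) y : ℚ) = κ := by
      simp_rw [h1, Finset.mul_sum]
      rw [Finset.sum_comm]
      simp_rw [h2]
      exact hflat y
    calc ∑ α ∈ Q.support, (κ⁻¹ * ∑ σ ∈ Finset.univ.filter (fun σ => e σ = α), w σ) * (α y : ℚ)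
        = κ⁻¹ * ∑ α ∈ Q.support, (∑ σ ∈ Finset.univ.filter (fun σ => e σ = α), w σ) * (α y : ℚ) := by
          rw [Finset.mul_sum]
          exact Finset.sum_congr rfl fun α _ => by ring
      _ = 1 := by rw [key, htot]; exact inv_mul_cancel₀ hκ.ne'

/-- **Design criterion for polystability.** If the label map `ℓ` admits (1') separating characters
(`∀ y ≠ y'` a diagonal `d` with `∏_i d_{ℓ(σ i,i)} = 1` for all `σ` and `d_y ≠ d_{y'}`) and (2') a
flat positive coupling `M`, then the labelled collapse `Q_ℓ = per_m(x_{ik} ↦ y_{ℓ(i,k)})` is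
POLYSTABLE. [cite: BurgisserIkenmeyer2017, Prop. 2.8 (corrected) and Cor. 2.9] -/
theorem isPolystable_labelCollapse_of_design
    (hsep : ∀ y y' : Fin j, y ≠ y' → ∃ d : Fin j → ℂ,
      (∀ σ : Equiv.Perm (Fin m), ∏ i : Fin m, d (lab (σ i, i)) = 1) ∧ d y ≠ d y')
    (M : Matrix (Fin m) (Fin m) ℚ) (hpos : ∀ i i', 0 < M i i')
    (hrow : ∀ i, ∑ i', M i i' = 1) (hcol : ∀ i', ∑ i, M i i' = 1) (κ : ℚ) (hκ : 0 < κ)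
    (hflat : ∀ y : Fin j, ∑ i : Fin m, ∑ i' : Fin m, (if lab (i', i) = y then M i i' else 0) = κ) :
    IsPolystable (MvPolynomial.rename lab (perPoly (Fin m) ℂ)) := by
  obtain ⟨c, hcpos, hc⟩ := labelCollapse_posCone lab M hpos hrow hcol κ hκ hflat
  refine isPolystable_of_separating_diagonalStabilizers _ (labelCollapse_isHomogeneous lab)
    (fun y y' h => ?_) c hcpos hc
  obtain ⟨d, hd, hdy⟩ := hsep y y' h
  exact ⟨d, linSubst_diagonal_labelCollapse_eq lab d hd, hdy⟩

/-- **Additive labels always separate.** For `ℓ(i,k) = a(i) + b(k)` with values in `ℤ/j` (any maps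
`a, b : [m] → Fin j`, `j, m ≥ 1`), hypothesis (1') holds: with `ζ = e^{2πi/j}` and `η = e^{2πi/(jm)}`
(`η^m = ζ`) the diagonal `d_y = ζ^y · η^{-S}`, `S = ∑_i (a i + b i)` read in `ℕ`, fixes every
monomial — `∏_i d_{ℓ(σ i,i)} = ζ^{∑_i ℓ(σ i,i)} η^{-mS} = ζ^{S} ζ^{-S} = 1` since
`∑_i ℓ(σ i, i) ≡ ∑_i a(σ i) + ∑_i b(i) = S (mod j)` is independent of `σ` — and `d_y ≠ d_{y'}` for
`y ≠ y'` because `ζ` is a primitive `j`-th root of unity (characters of `ℤ/j` separate points).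
[folklore] -/
theorem additive_labels_separating [NeZero j] (a b : Fin m → Fin j) (hm : 0 < m) (y y' : Fin j)
    (hyy : y ≠ y') :
    ∃ d : Fin j → ℂ,
      (∀ σ : Equiv.Perm (Fin m), ∏ i : Fin m, d (a (σ i) + b i) = 1) ∧ d y ≠ d y' := by
  classical
  have hj0 : j ≠ 0 := NeZero.ne j
  set ζ : ℂ := Complex.exp (2 * Real.pi * Complex.I / j) with hζdef
  have hζ : IsPrimitiveRoot ζ j := Complex.isPrimitiveRoot_exp j hj0
  have hζ0 : ζ ≠ 0 := hζ.ne_zero hj0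
  -- the σ-independent total label, read in ℕ modulo j
  set S : ℕ := ∑ i : Fin m, ((a i : ℕ) + (b i : ℕ)) with hS
  -- an m-th root `t` of `ζ^{-S}`: `t = η^{-S}` for a primitive `(j m)`-th root `η` with `η^m = ζ`
  set η : ℂ := Complex.exp (2 * Real.pi * Complex.I / ((j * m : ℕ) : ℂ)) with hηdef
  have hjm0 : j * m ≠ 0 := Nat.mul_ne_zero hj0 hm.ne'
  have hη : IsPrimitiveRoot η (j * m) := Complex.isPrimitiveRoot_exp (j * m) hjm0
  have hη0 : η ≠ 0 := hη.ne_zero hjm0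
  have hηm : η ^ m = ζ := by
    rw [hηdef, hζdef, ← Complex.exp_nat_mul]
    congr 1
    have hmC : (m : ℂ) ≠ 0 := by exact_mod_cast hm.ne'
    push_cast
    field_simp
  refine ⟨fun r => ζ ^ (r : ℕ) * (η ^ S)⁻¹, fun σ => ?_, ?_⟩
  · rw [Finset.prod_mul_distrib, Finset.prod_pow_eq_pow_sum, Finset.prod_const, Finset.card_univ,
      Fintype.card_fin]
    have hmod : (∑ i : Fin m, ((a (σ i) + b i : Fin j) : ℕ)) ≡ S [MOD j] := by
      have hsum : ∑ i : Fin m, ((a (σ i) : ℕ) + (b i : ℕ)) = S := by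
        rw [hS, Finset.sum_add_distrib, Finset.sum_add_distrib,
          Equiv.sum_comp σ (fun i : Fin m => (a i : ℕ))]
      unfold Nat.ModEq
      rw [← hsum, Finset.sum_nat_mod, Finset.sum_nat_mod (Finset.univ) j (fun i : Fin m => _ + _)]
      congr 1
      refine Finset.sum_congr rfl fun i _ => ?_
      rw [Fin.val_add, Nat.mod_mod]
    have hpow : ζ ^ (∑ i : Fin m, ((a (σ i) + b i : Fin j) : ℕ)) = ζ ^ S := by
      rw [pow_eq_pow_mod _ hζ.pow_eq_one, hmod, ← pow_eq_pow_mod _ hζ.pow_eq_one]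
    rw [hpow, inv_pow, ← pow_mul, ← hηm, ← pow_mul, mul_comm m S]
    exact mul_inv_cancel₀ (pow_ne_zero _ hη0)
  · intro h
    apply hyy
    have h' : ζ ^ (y : ℕ) = ζ ^ (y' : ℕ) :=
      mul_right_cancel₀ (inv_ne_zero (pow_ne_zero _ hη0)) h
    exact Fin.ext (hζ.pow_inj y.isLt y'.isLt h')

end Design

/-! ### 3. Placement in `Δ(per_m)` and the rays -/

section Rays

variable {m j : ℕ}

/-- **Every labelled collapse, placed anywhere, is a degeneration of the permanent**: for any map
`κ : [j] → MatIdx m`, `Q_ℓ` placed along `κ` is the renaming `x_{ik} ↦ x_{κ(ℓ(i,k))}` of `per_m`,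
a point of the endomorphism orbit, hence of `Δ(per_m)`. [cite: MulmuleySohoni2001, §4] -/
theorem rename_labelCollapse_mem_orbitClosure_per (lab : Fin m × Fin m → Fin j)
    (κ : Fin j → MatIdx m) :
    MvPolynomial.rename κ (MvPolynomial.rename lab (perPoly (Fin m) ℂ)) ∈
      orbitClosure (MvPolynomial.rename (toLex : Fin m × Fin m → MatIdx m) (perPoly (Fin m) ℂ)) := by
  haveI : Infinite ℂ := CharZero.infinite ℂ
  have hmem := rename_mem_orbitClosure_of_selfMap (fun x : MatIdx m => κ (lab (ofLex x)))
    (MvPolynomial.rename (toLex : Fin m × Fin m → MatIdx m) (perPoly (Fin m) ℂ))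
  rw [rename_rename] at hmem
  rw [rename_rename]
  have hfun : (κ ∘ lab) = ((fun x : MatIdx m => κ (lab (ofLex x))) ∘
      (toLex : Fin m × Fin m → MatIdx m)) := by
    funext ik
    simp only [Function.comp_apply, ofLex_toLex]
  rw [hfun]
  exact hmem

/-- **Design criterion for the rays of `S(per_m)`.** Let `1 ≤ j ≤ m²` and let `ℓ : [m]² → [j]`
admit separating characters (1') and a flat positive coupling (2'). Then the chamber ray `(1^j)^*`
of `S(per_m)` is HIT: `(k^j)^*` occurs in `ℂ[Δ_m[per_m]]` for some `k ≥ 1` (polystable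
`j`-variable degeneration + ray criterion). [cite: BurgisserIkenmeyer2017, Prop. 2.8 and Def. 3.3] -/
theorem per_ray_hit_of_design (hj : 0 < j) (hjm : j ≤ m * m) (lab : Fin m × Fin m → Fin j)
    (hsep : ∀ y y' : Fin j, y ≠ y' → ∃ d : Fin j → ℂ,
      (∀ σ : Equiv.Perm (Fin m), ∏ i : Fin m, d (lab (σ i, i)) = 1) ∧ d y ≠ d y')
    (M : Matrix (Fin m) (Fin m) ℚ) (hpos : ∀ i i', 0 < M i i')
    (hrow : ∀ i, ∑ i', M i i' = 1) (hcol : ∀ i', ∑ i, M i i' = 1) (κ : ℚ) (hκ : 0 < κ)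
    (hflat : ∀ y : Fin j, ∑ i : Fin m, ∑ i' : Fin m, (if lab (i', i) = y then M i i' else 0) = κ) :
    ∃ k : ℕ, 0 < k ∧
      highestWeightSpace (orbitCoordRep (MvPolynomial.rename toLex (perPoly (Fin m) ℂ)) m)
        (partitionWeightLex m (Nat.Partition.rectangle j k)) ≠ ⊥ := by
  have hm : m ≠ 0 := by
    rintro rfl
    exact absurd hjm (by omega)
  have hκinj : Function.Injective (fun y : Fin j => matIdxEquiv m (Fin.castLE hjm y)) :=
    fun y y' h => Fin.castLE_injective hjm ((matIdxEquiv m).injective h)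
  obtain ⟨k, hk, hocc⟩ := exists_hasHighestWeight_rectangle_of_isSLSemistable_projection
    (matIdxEquiv m) hm (perFormLex_isHomogeneous m) hj _ hκinj
    (labelCollapse_isHomogeneous lab) (rename_labelCollapse_mem_orbitClosure_per lab _)
    ((isPolystable_labelCollapse_of_design lab hsep M hpos hrow hcol κ hκ hflat).isSLSemistable
      (labelCollapse_ne_zero lab))
  exact ⟨k, hk, hocc⟩

/-- **Design criterion, atom form**: under the hypotheses of `per_ray_hit_of_design` the ray `j`
of `S(per_m)` starts with an ATOM `(k₀^j)^*`. [cite: BurgisserIkenmeyer2017, Prop. 2.8 and Def. 3.3] -/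
theorem per_exists_ray_atom_of_design (hj : 0 < j) (hjm : j ≤ m * m) (lab : Fin m × Fin m → Fin j)
    (hsep : ∀ y y' : Fin j, y ≠ y' → ∃ d : Fin j → ℂ,
      (∀ σ : Equiv.Perm (Fin m), ∏ i : Fin m, d (lab (σ i, i)) = 1) ∧ d y ≠ d y')
    (M : Matrix (Fin m) (Fin m) ℚ) (hpos : ∀ i i', 0 < M i i')
    (hrow : ∀ i, ∑ i', M i i' = 1) (hcol : ∀ i', ∑ i, M i i' = 1) (κ : ℚ) (hκ : 0 < κ)
    (hflat : ∀ y : Fin j, ∑ i : Fin m, ∑ i' : Fin m, (if lab (i', i) = y then M i i' else 0) = κ) :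
    ∃ k₀ : ℕ, 0 < k₀ ∧
      highestWeightSpace (orbitCoordRep (MvPolynomial.rename toLex (perPoly (Fin m) ℂ)) m)
        (partitionWeightLex m (Nat.Partition.rectangle j k₀)) ≠ ⊥ ∧
      (∀ k : ℕ, 0 < k → k < k₀ →
        highestWeightSpace (orbitCoordRep (MvPolynomial.rename toLex (perPoly (Fin m) ℂ)) m)
          (partitionWeightLex m (Nat.Partition.rectangle j k)) = ⊥) ∧
      (∀ χ₁ χ₂ : Weight (MatIdx m),
        χ₁ + χ₂ = partitionWeightLex m (Nat.Partition.rectangle j k₀) →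
        χ₁ ≠ 0 → χ₂ ≠ 0 →
        highestWeightSpace (orbitCoordRep (MvPolynomial.rename toLex (perPoly (Fin m) ℂ)) m) χ₁ = ⊥ ∨
          highestWeightSpace (orbitCoordRep (MvPolynomial.rename toLex (perPoly (Fin m) ℂ)) m) χ₂ = ⊥) :=
  exists_least_rectangle_atom _ _ hj hjm
    (per_ray_hit_of_design hj hjm lab hsep M hpos hrow hcol κ hκ hflat)

/-- **Additive designs.** For additive labels `ℓ(i,k) = a(i) + b(k) ∈ ℤ/j` (`1 ≤ j ≤ m²`, any
`a, b : [m] → Fin j`) hypothesis (1') is automatic (`additive_labels_separating`), so a flat positive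
coupling ALONE — a doubly stochastic `M > 0` with `∑_{a(i') + b(i) = y} M_{i i'}` constant in `y` —
makes the ray `j` of `S(per_m)` hit. [cite: BurgisserIkenmeyer2017, Prop. 2.8 and Def. 3.3] -/
theorem per_ray_hit_of_additive_design [NeZero j] (hjm : j ≤ m * m) (a b : Fin m → Fin j)
    (M : Matrix (Fin m) (Fin m) ℚ) (hpos : ∀ i i', 0 < M i i')
    (hrow : ∀ i, ∑ i', M i i' = 1) (hcol : ∀ i', ∑ i, M i i' = 1) (κ : ℚ) (hκ : 0 < κ)
    (hflat : ∀ y : Fin j, ∑ i : Fin m, ∑ i' : Fin m, (if a i' + b i = y then M i i' else 0) = κ) :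
    ∃ k : ℕ, 0 < k ∧
      highestWeightSpace (orbitCoordRep (MvPolynomial.rename toLex (perPoly (Fin m) ℂ)) m)
        (partitionWeightLex m (Nat.Partition.rectangle j k)) ≠ ⊥ := by
  have hj : 0 < j := Nat.pos_of_ne_zero (NeZero.ne j)
  have hm : 0 < m := by
    rcases Nat.eq_zero_or_pos m with h | h
    · subst h; exact absurd hjm (by omega)
    · exact h
  exact per_ray_hit_of_design hj hjm (fun ik => a ik.1 + b ik.2)
    (fun y y' h => additive_labels_separating a b hm y y' h) M hpos hrow hcol κ hκ hflat

end Rays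

end Summit.ValiantsHypothesis.ValiantsHypothesis.Theorems.GeneratorObstructions.PerGenDegreeSuperQP

end
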